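import Mathlib
import Summits.Ventures.LatticeQCDFlow.TrivializingMaps.LinkSymmetry
import Summits.Ventures.LatticeQCDFlow.TrivializingMaps.DefectLogWeightMeasure
import Summits.Ventures.LatticeQCDFlow.TrivializingMaps.TruncatedMapLogWeight
import Summits.Ventures.LatticeQCDFlow.TrivializingMaps.TruncatedFlowReceptiveField
import Literature.MathematicalPhysics.QuantumFieldTheory.Luscher2010.FlowExistenceProofs
import HarnessLib

/-!
HONEST FRAMING: exact (Metropolis-corrected) sampling algorithms for lattice gauge theory; figures
of merit are autocorrelation/cost numbers at stated couplings and volumes; no continuum-physics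
claim.

# TruncatedFlowTranslation — the order-`N` Wilson-flow map COMMUTES WITH LATTICE TRANSLATIONS, and so
# does its strictly local approximant: ONE local rule at every link (cell pub-lqcd, lean-2 GEN-5)

`TruncatedFlowReceptiveField.lean` shows that the time-`t` map `Φ_t` of Lüscher's order-`N` truncated
generator `-∂S̃^{[N]}_t` (ANY smooth solution of the recursion for `β·S_W`) is, up to
`2n e^{ct}(ct)^m/m!` per link, the strictly local map `localize (2(N+1)) m V₀ (Φ t)` of range `2(N+1)·m`,
every volume.  The network-size reading of THEORY-1 §26.3 (a) has a second half: "(translation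
covariance, `LinkSymmetry`) the SAME local rule at every link".  This file proves it:

* §1 `translateCfg a V = V ∘ τ_a` (`τ_a (x, μ) = (x + a, μ)`, tree `translateLinks`); the generator is
  translation COVARIANT on `SU(n)^E` for every smooth Lüscher series of `β·S_W`
  (`linkGrad_truncFlowAction_translate`, from the tree's `IsLuscherSeries.linkDeriv_translate_of_smul_
  ambWilsonAction`), translated flow lines are flow lines (`isFlowLine_translate`), and — by the
  uniqueness clause of Lüscher's §3.1 global existence theorem (tree `flowGlobalExistence_holds`) —
  **`truncFlow_translate`: `Φ_t(V ∘ τ_a) = Φ_t(V) ∘ τ_a`** for EVERY flow map `Φ` of the truncated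
  generator (`IsFlowMap`), every `a`, `t`, `V`, every volume;
* §2 plaquette balls are translation covariant (`mem_linkBall_translate`), hence freezing outside a ball
  to a CONSTANT reference field commutes with translations, and
  **`localize_truncFlow_translate`: `Ψ(V ∘ τ_a) = Ψ(V) ∘ τ_a`** for the strictly local approximant
  `Ψ = localize (2(N+1)) m (const u₀) (Φ t)` — its rule at link `τ_a e` is its rule at `e` read on the
  translated input: one local rule of receptive radius `2(N+1)·m` serves every link and every volume.

NOT claimed: any parameter count or cost statement; covariance under lattice rotations/reflections (true
for `S_W`, not typed here).

References: M. Lüscher, Commun. Math. Phys. 293 (2010) 899 [Luscher2010Trivializing], §3.1 (uniqueness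
of flow lines), §4.3–§4.4 eq. (4.19) ("the sums … extend over all possible positions of the loops");
THEORY-1.md §26.3 (a).
-/

noncomputable section

namespace Summit.Ventures.LatticeQCDFlow.TrivializingMaps

open Literature.MathematicalPhysics.QuantumFieldTheory
open Literature.MathematicalPhysics.QuantumFieldTheory.Luscher2010
open Literature.MathematicalPhysics.QuantumFieldTheory.WilsonFlow (coeConfig)
open scoped Matrix Matrix.Norms.Frobenius ContDiff

variable {d L n : ℕ}

/-! ## §1. Translation covariance of the generator and of the flow map -/

section Flow

/-- Translate a configuration: `(V ∘ τ_a)(x, μ) = V(x + a, μ)`. [folklore] -/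
def translateCfg {G : Type*} (a : Site d L) (V : GaugeConfig d L G) : GaugeConfig d L G :=
  fun e => V (translateLinks a e)

/-- Unfolding lemma. [folklore] -/
@[simp] theorem translateCfg_apply {G : Type*} (a : Site d L) (V : GaugeConfig d L G) (e : Edge d L) :
    translateCfg a V e = V (translateLinks a e) := rfl

/-- `ι(V ∘ τ_a) = ι(V) ∘ τ_a`. [folklore] -/
theorem coeConfig_translateCfg (a : Site d L)
    (V : GaugeConfig d L (Matrix.specialUnitaryGroup (Fin n) ℂ)) (e : Edge d L) :
    coeConfig (translateCfg a V) e = coeConfig V (translateLinks a e) := by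
  simp only [WilsonFlow.coeConfig_apply, translateCfg_apply]

variable [NeZero L]

/-- **The order-`N` generator is translation covariant on `SU(n)^E`**: for every smooth solution of
Lüscher's recursion for `β·S_W`, `∂S̃^{[N]}_t(ιU)(τ_a e) = ∂S̃^{[N]}_t(ι(U ∘ τ_a))(e)`.
[cite: Luscher2010Trivializing, §4.3–§4.4 eq. (4.19)] -/
theorem linkGrad_truncFlowAction_translate (B : SuBasis n) (β : ℝ) {Sk : ℕ → AmbConfig d L n → ℝ}
    {c : ℕ → ℝ} (hsm : ∀ k, ContDiff ℝ ∞ (Sk k))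
    (hser : IsLuscherSeries B (fun W => β * ambWilsonAction W) Sk c) (t : ℝ) (N : ℕ) (a : Site d L)
    (U : GaugeConfig d L (Matrix.specialUnitaryGroup (Fin n) ℂ)) (e : Edge d L) :
    linkGrad B (truncFlowAction Sk t N) (coeConfig U) (translateLinks a e) =
      linkGrad B (truncFlowAction Sk t N) (coeConfig (translateCfg a U)) e := by
  obtain ⟨x, μ⟩ := e
  simp only [linkGrad, translateLinks_apply]
  refine Finset.sum_congr rfl fun b _ => ?_
  rw [linkDeriv_truncFlowAction hsm, linkDeriv_truncFlowAction hsm]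
  congr 2
  refine Finset.sum_congr rfl fun k _ => ?_
  rw [IsLuscherSeries.linkDeriv_translate_of_smul_ambWilsonAction β hser hsm a x μ k (B.mem b) U]
  rfl

/-- **Translated flow lines are flow lines**: if `t ↦ Φ_t V` integrates `Z_t = -∂S̃^{[N]}_t`, so does
`t ↦ Φ_t(V) ∘ τ_a`, from `V ∘ τ_a`. [cite: Luscher2010Trivializing, §3.1 eq. (3.2)] -/
theorem isFlowLine_translate (B : SuBasis n) (β : ℝ) {Sk : ℕ → AmbConfig d L n → ℝ} {c : ℕ → ℝ}
    (hsm : ∀ k, ContDiff ℝ ∞ (Sk k)) (hser : IsLuscherSeries B (fun W => β * ambWilsonAction W) Sk c)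
    (N : ℕ) {Φ : ℝ → GaugeConfig d L (Matrix.specialUnitaryGroup (Fin n) ℂ) →
      GaugeConfig d L (Matrix.specialUnitaryGroup (Fin n) ℂ)}
    (hΦ : IsFlowMap (fun t W => -linkGrad B (truncFlowAction Sk t N) W) Φ) (a : Site d L)
    (V : GaugeConfig d L (Matrix.specialUnitaryGroup (Fin n) ℂ)) :
    IsFlowLine (fun t W => -linkGrad B (truncFlowAction Sk t N) W)
      fun s => coeConfig (translateCfg a (Φ s V)) := by
  intro t e i j
  have h := hΦ.2 V t (translateLinks a e) i j
  have hfun : (fun s => coeConfig (Φ s V) (translateLinks a e) i j) =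
      fun s => coeConfig (translateCfg a (Φ s V)) e i j := by
    funext s; rw [coeConfig_translateCfg]
  rw [hfun] at h
  have hval : ((fun t W => -linkGrad B (truncFlowAction Sk t N) W) t (coeConfig (Φ t V))
        (translateLinks a e) * coeConfig (Φ t V) (translateLinks a e)) =
      ((fun t W => -linkGrad B (truncFlowAction Sk t N) W) t (coeConfig (translateCfg a (Φ t V))) e *
        coeConfig (translateCfg a (Φ t V)) e) := by
    simp only [Pi.neg_apply]
    rw [linkGrad_truncFlowAction_translate B β hsm hser t N a (Φ t V) e, coeConfig_translateCfg]
  rw [hval] at h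
  exact h

/-- **THE ORDER-`N` FLOW MAP COMMUTES WITH TRANSLATIONS**: for every smooth solution of Lüscher's
recursion for `β·S_W`, every flow map `Φ` of `-∂S̃^{[N]}_t` and every lattice vector `a`:
`Φ_t(V ∘ τ_a) = Φ_t(V) ∘ τ_a` (both sides are flow lines from `V ∘ τ_a`; uniqueness of flow lines,
Lüscher §3.1, tree `flowGlobalExistence_holds`). [cite: Luscher2010Trivializing, §3.1, §4.4 eq. (4.19)] -/
theorem truncFlow_translate (B : SuBasis n) (β : ℝ) {Sk : ℕ → AmbConfig d L n → ℝ} {c : ℕ → ℝ}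
    (hsm : ∀ k, ContDiff ℝ ∞ (Sk k)) (hser : IsLuscherSeries B (fun W => β * ambWilsonAction W) Sk c)
    (N : ℕ) {Φ : ℝ → GaugeConfig d L (Matrix.specialUnitaryGroup (Fin n) ℂ) →
      GaugeConfig d L (Matrix.specialUnitaryGroup (Fin n) ℂ)}
    (hΦ : IsFlowMap (fun t W => -linkGrad B (truncFlowAction Sk t N) W) Φ) (a : Site d L)
    (V : GaugeConfig d L (Matrix.specialUnitaryGroup (Fin n) ℂ)) (t : ℝ) :
    Φ t (translateCfg a V) = translateCfg a (Φ t V) := by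
  obtain ⟨Φ₀, hΦ₀, -, huniq⟩ := (flowGlobalExistence_holds : FlowGlobalExistence d L n)
    (fun t W => -linkGrad B (truncFlowAction Sk t N) W)
    (contDiff_one_neg_linkGrad_param B (F := fun t => truncFlowAction Sk t N)
      (contDiff_truncFlowAction_param hsm N))
    (isTangent_neg_linkGrad B fun t => truncFlowAction Sk t N)
  apply WilsonFlow.coeConfig_injective
  -- both `s ↦ Φ_s(V ∘ τ_a)` and `s ↦ Φ_s(V) ∘ τ_a` are the flow line of `Φ₀` from `V ∘ τ_a`
  have h1 : coeConfig (Φ t (translateCfg a V)) = coeConfig (Φ₀ t (translateCfg a V)) :=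
    huniq (fun s => coeConfig (Φ s (translateCfg a V))) (translateCfg a V) (hΦ.2 _)
      (by simp only [hΦ.1]) t
  have h2 : coeConfig (translateCfg a (Φ t V)) = coeConfig (Φ₀ t (translateCfg a V)) :=
    huniq (fun s => coeConfig (translateCfg a (Φ s V))) (translateCfg a V)
      (isFlowLine_translate B β hsm hser N hΦ a V) (by simp only [hΦ.1]) t
  rw [h1, h2]

end Flow

/-! ## §2. Plaquette balls, freezing and the local rule are translation covariant -/

section Balls

/-- Shifting commutes with translating. [folklore] -/
theorem shift_add (x a : Site d L) (μ : Fin d) : (x + a).shift μ = x.shift μ + a := by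
  simp only [Site.shift]; abel

/-- Plaquettes translate to plaquettes. [folklore] -/
theorem mem_plaqLinks_translate (a x : Site d L) (μ ν : Fin d) (e : Edge d L) :
    translateLinks a e ∈ plaqLinks (x + a) μ ν ↔ e ∈ plaqLinks x μ ν := by
  obtain ⟨y, κ⟩ := e
  simp only [plaqLinks, translateLinks_apply, Set.mem_insert_iff, Set.mem_singleton_iff, Prod.mk.injEq,
    shift_add, add_left_inj]

/-- Plaquette neighbourhoods translate to plaquette neighbourhoods. [folklore] -/
theorem mem_plaqNbhd_translate (a : Site d L) (e e' : Edge d L) :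
    translateLinks a e' ∈ plaqNbhd (translateLinks a e) ↔ e' ∈ plaqNbhd e := by
  simp only [plaqNbhd, Set.mem_setOf_eq]
  constructor
  · rintro ⟨y, μ, ν, hμν, h1, h2⟩
    refine ⟨y - a, μ, ν, hμν, ?_, ?_⟩
    · rwa [← mem_plaqLinks_translate a, sub_add_cancel]
    · rwa [← mem_plaqLinks_translate a, sub_add_cancel]
  · rintro ⟨x, μ, ν, hμν, h1, h2⟩
    exact ⟨x + a, μ, ν, hμν, (mem_plaqLinks_translate a x μ ν e).2 h1,
      (mem_plaqLinks_translate a x μ ν e').2 h2⟩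

/-- **Plaquette balls are translation covariant**: `τ_a e' ∈ linkBall R (τ_a e) ↔ e' ∈ linkBall R e`.
[folklore] -/
theorem mem_linkBall_translate (a : Site d L) :
    ∀ (R : ℕ) (e e' : Edge d L), translateLinks a e' ∈ linkBall R (translateLinks a e) ↔ e' ∈ linkBall R e
  | 0, e, e' => by
      rw [mem_linkBall_zero, mem_linkBall_zero]
      exact (translateLinks a).injective.eq_iff
  | R + 1, e, e'' => by
      rw [mem_linkBall_succ, mem_linkBall_succ]
      constructor
      · rintro ⟨f, hf, hP⟩
        refine ⟨(translateLinks a).symm f, ?_, ?_⟩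
        · rw [← mem_linkBall_translate a R e, Equiv.apply_symm_apply]; exact hf
        · rcases hP with h | h
          · left; rw [← h, Equiv.symm_apply_apply]
          · right
            rw [← mem_plaqNbhd_translate a, Equiv.apply_symm_apply]; exact h
      · rintro ⟨f, hf, hP⟩
        refine ⟨translateLinks a f, (mem_linkBall_translate a R e f).2 hf, ?_⟩
        rcases hP with h | h
        · left; rw [h]
        · right; exact (mem_plaqNbhd_translate a f e'').2 h

/-- Freezing outside a plaquette ball to a CONSTANT reference field commutes with translations.
[ours] -/
theorem freezeOutside_linkBall_translate {G : Type*} (a : Site d L) (R : ℕ) (e : Edge d L) (u₀ : G)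
    (V : GaugeConfig d L G) :
    freezeOutside (linkBall R e) (fun _ => u₀) (translateCfg a V) =
      translateCfg a (freezeOutside (linkBall R (translateLinks a e)) (fun _ => u₀) V) := by
  funext e'
  classical
  by_cases he' : e' ∈ linkBall R e
  · rw [freezeOutside_of_mem _ _ he', translateCfg_apply, translateCfg_apply,
      freezeOutside_of_mem _ _ ((mem_linkBall_translate a R e e').2 he')]
  · rw [freezeOutside_of_not_mem _ _ he', translateCfg_apply,
      freezeOutside_of_not_mem _ _ (fun h => he' ((mem_linkBall_translate a R e e').1 h))]

/-- **The local rule commutes with translations** whenever the map does: for a translation-covariant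
field map `F` (`F(V ∘ τ_a) = F(V) ∘ τ_a`) and a constant reference field,
`localize R m (const u₀) F (V ∘ τ_a) = (localize R m (const u₀) F V) ∘ τ_a` — the rule at link `τ_a e`
is the rule at `e` read on the translated input. [ours] -/
theorem localize_translate {G : Type*} (R m : ℕ) (u₀ : G) {F : GaugeConfig d L G → GaugeConfig d L G}
    (hF : ∀ (a : Site d L) (V : GaugeConfig d L G), F (translateCfg a V) = translateCfg a (F V))
    (a : Site d L) (V : GaugeConfig d L G) :
    localize R m (fun _ => u₀) F (translateCfg a V) = translateCfg a (localize R m (fun _ => u₀) F V) := by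
  funext e
  rw [localize_apply, translateCfg_apply, localize_apply, freezeOutside_linkBall_translate, hF,
    translateCfg_apply]

end Balls

/-- **ONE LOCAL RULE AT EVERY LINK.**  For every smooth solution of Lüscher's recursion for `β·S_W`,
every flow map `Φ` of `-∂S̃^{[N]}_t`, every `t`, `m`, constant reference field `u₀` and lattice vector
`a`, the strictly local approximant `Ψ = localize (2(N+1)) m (const u₀) (Φ t)` of
`TruncatedFlowReceptiveField` (range `2(N+1)·m`, within `2n e^{ct}(ct)^m/m!` of `Φ_t` per link, every
volume) satisfies `Ψ(V ∘ τ_a) = Ψ(V) ∘ τ_a`. [ours; cf. Luscher2010Trivializing §3.1, §4.4 eq. (4.19)] -/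
theorem localize_truncFlow_translate [NeZero L] (B : SuBasis n) (β : ℝ)
    {Sk : ℕ → AmbConfig d L n → ℝ} {c : ℕ → ℝ} (hsm : ∀ k, ContDiff ℝ ∞ (Sk k))
    (hser : IsLuscherSeries B (fun W => β * ambWilsonAction W) Sk c) (N : ℕ)
    {Φ : ℝ → GaugeConfig d L (Matrix.specialUnitaryGroup (Fin n) ℂ) →
      GaugeConfig d L (Matrix.specialUnitaryGroup (Fin n) ℂ)}
    (hΦ : IsFlowMap (fun t W => -linkGrad B (truncFlowAction Sk t N) W) Φ) (t : ℝ) (m : ℕ)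
    (u₀ : Matrix.specialUnitaryGroup (Fin n) ℂ) (a : Site d L)
    (V : GaugeConfig d L (Matrix.specialUnitaryGroup (Fin n) ℂ)) :
    localize (2 * (N + 1)) m (fun _ => u₀) (Φ t) (translateCfg a V) =
      translateCfg a (localize (2 * (N + 1)) m (fun _ => u₀) (Φ t) V) :=
  localize_translate _ m u₀ (fun a' V' => truncFlow_translate B β hsm hser N hΦ a' V' t) a V

end Summit.Ventures.LatticeQCDFlow.TrivializingMaps

end
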